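import Mathlib
import Literature.Analysis.OperatorTheory.HilbertInequality
import Summits.ValiantsHypothesis.ValiantsHypothesis.Theorems.FeketeSOSCharPSparseSOSQRPerfectBarrier

/-!
# Crux `FeketeSOS.CharPSparseSOS` (stmt-ValiantsHypothesis-14989) — ordered-side calibration:
the Sidon harmonic-mass lemma and the bounded-fan-in obstruction

The crux-strategist's census (`Cruxes/CharPSparseSOS/STRATEGY-CENSUS.md` §0, §Transfer T1) locates the
wall of the CYCLIC crux (★) `CharPSparseSOS` in near-perfect packings of the quadratic residues by restricted
sumsets `Q +̂ Q` of a few weak-Sidon sets `Q ⊆ 𝔽_p` ((CORE), `coreSumClique_of_charPSparseSOS`, p146769: an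
additive power below counting, nothing below counting in print), and certifies a route-level door: the
ORDERED shadow (★ord) (`charPSparseSOSOrdered_of_charPSparseSOS`, `feketeSOSHard_of_ordered`, p152605).  The
reason the door is not the same wall is a THEOREM on the ordered side, typed in the census as
`Strategist.SidonHarmonicMass` and `Strategist.OrderedBoundedFaninObstruction` and proved here verbatim:

* `sidonHarmonicMass` — for a weak-Sidon set `Q ⊆ ℕ` (restricted pair sums pairwise distinct), `1 ≤ h`,
  `4h ≤ L`: the pairs `a < b` of `Q` with `a + b ≥ L` have harmonic mass
  `Σ 1/(a+b) ≤ (π/(2h))·(4h + |Q|)·(1 + 4h/L)` — Erdős's block count (a weak-Sidon set meets the blocks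
  `[jh, (j+1)h)` in `x_j` points with `Σ_j x_j² ≤ |Q| + 4h`, since every positive difference is attained at
  most twice, `shm_card_sameBlock_le`) times Hilbert's inequality `Σ x_j x_k/((j+1)+(k+1)) ≤ π Σ x_j²`
  (`Literature.Analysis.OperatorTheory.HilbertInequality.hilbert_inequality`).
* `orderedBoundedFaninObstruction` — consequently a once-covering of an integer interval `[L, N)` by the
  restricted sumsets of `s'` weak-Sidon sets of size `≤ h` (`4h ≤ L`) needs `log(N/L) − 1 ≤ s'·10π·(h/(2h))`,
  i.e. `s' ≫ log(N/L)` pieces: bounded fan-in Sidon-regime configurations, which ARE the cyclic barrier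
  (`{3,5,6} +̂ {3,5,6} = QR₇`, the 2-piece packing of `QR₄₁`), do not exist in `K[X]` / over `ℂ` at large
  scale ratio.  (The Fekete application covers `QR ∩ [p^{1/2+2δ}, p)`, of harmonic mass `(¼ − δ) log p` by
  Pólya–Vinogradov; that input is not formalised here.)

Lead c7 of the crux; `--supports stmt-ValiantsHypothesis-14989` (registered sub-goals `sidonHarmonicMass`,
`orderedBoundedFaninObstruction`).  Calibration of the planning decision only: nothing here bears on the open
residual of line `Sketch` (`stub_twoCuspInequality` ≡ the crux at full depth, p115769).
-/

-- `Summit.ValiantsHypothesis.ValiantsHypothesis.…` is the tree's mandated single-conjunct layout (Sub = Summit).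
set_option linter.dupNamespace false

namespace Summit.ValiantsHypothesis.ValiantsHypothesis.Theorems.CharPSparseSOSTwoCusp

open Finset
open Literature.Analysis.OperatorTheory.HilbertInequality (hilbert_inequality)

/-- In a weak-Sidon set of naturals every positive difference is attained by at most two pairs `a < b`:
two pairs `(a₁, a₁ + d)`, `(a₂, a₂ + d)` with `a₁ < a₂` give the coincidence `a₁ + (a₂ + d) = a₂ + (a₁ + d)`
of restricted sums, non-trivial unless they chain (`a₂ = a₁ + d`), and three naturals cannot pairwise differ
by the same `d > 0`. [folklore] -/
theorem shm_card_pairs_with_diff_le_two (Q : Finset ℕ)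
    (hws : ∀ a ∈ Q, ∀ b ∈ Q, ∀ c ∈ Q, ∀ d ∈ Q, a ≠ b → c ≠ d → a + b = c + d →
      (a = c ∧ b = d) ∨ (a = d ∧ b = c))
    (U : Finset (ℕ × ℕ)) (hU : ∀ x ∈ U, x.1 ∈ Q ∧ x.2 ∈ Q ∧ x.1 < x.2) (d : ℕ) :
    (U.filter (fun x => x.2 - x.1 = d)).card ≤ 2 := by
  by_contra hlt
  push Not at hlt
  obtain ⟨x, hx, y, hy, z, hz, hxy, hxz, hyz⟩ := Finset.two_lt_card.1 hlt
  simp only [mem_filter] at hx hy hz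
  obtain ⟨hxU, hxd⟩ := hx
  obtain ⟨hyU, hyd⟩ := hy
  obtain ⟨hzU, hzd⟩ := hz
  obtain ⟨hx1, hx2, hx12⟩ := hU x hxU
  obtain ⟨hy1, hy2, hy12⟩ := hU y hyU
  obtain ⟨hz1, hz2, hz12⟩ := hU z hzU
  -- the chaining lemma
  have chain : ∀ u ∈ U, ∀ v ∈ U, u.2 - u.1 = d → v.2 - v.1 = d → u.1 < v.1 → v.1 = u.1 + d := by
    intro u hu v hv hud hvd huv
    obtain ⟨hu1, hu2, hu12⟩ := hU u hu
    obtain ⟨hv1, hv2, hv12⟩ := hU v hv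
    by_contra hne
    have hsum : u.1 + v.2 = v.1 + u.2 := by omega
    have h1 : u.1 ≠ v.2 := by omega
    have h2 : v.1 ≠ u.2 := by omega
    rcases hws u.1 hu1 v.2 hv2 v.1 hv1 u.2 hu2 h1 h2 hsum with ⟨h3, _⟩ | ⟨h3, _⟩
    · omega
    · omega
  have hd : 0 < d := by omega
  -- first coordinates are pairwise distinct
  have e_xy : x.1 ≠ y.1 := by
    intro h; apply hxy; exact Prod.ext h (by omega)
  have e_xz : x.1 ≠ z.1 := by
    intro h; apply hxz; exact Prod.ext h (by omega)
  have e_yz : y.1 ≠ z.1 := by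
    intro h; apply hyz; exact Prod.ext h (by omega)
  have cxy := chain x hxU y hyU hxd hyd
  have cyx := chain y hyU x hxU hyd hxd
  have cxz := chain x hxU z hzU hxd hzd
  have czx := chain z hzU x hxU hzd hxd
  have cyz := chain y hyU z hzU hyd hzd
  have czy := chain z hzU y hyU hzd hyd
  rcases lt_or_gt_of_ne e_xy with h1 | h1 <;> rcases lt_or_gt_of_ne e_xz with h2 | h2 <;>
    rcases lt_or_gt_of_ne e_yz with h3 | h3
  all_goals
    first
    | (have := cxy h1; have := cxz h2; omega)
    | (have := cxy h1; have := czx h2; have := cyz h3; omega)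
    | (have := cxy h1; have := czx h2; have := czy h3; omega)
    | (have := cyx h1; have := cxz h2; have := cyz h3; omega)
    | (have := cyx h1; have := cxz h2; have := czy h3; omega)
    | (have := cyx h1; have := czx h2; omega)

/-- **Erdős-type block count for weak-Sidon sets.**  If `Q ⊆ ℕ` is weak Sidon and `1 ≤ h`, the number of
ordered pairs `(a, b) ∈ Q²` lying in a common block `[jh, (j+1)h)` is at most `|Q| + 4h` (diagonal `|Q|`,
plus twice the pairs `a < b` in a common block, whose differences lie in `[1, h)` and are attained at most
twice each). [folklore] -/
theorem shm_card_sameBlock_le (Q : Finset ℕ) (h : ℕ) (hh : 1 ≤ h)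
    (hws : ∀ a ∈ Q, ∀ b ∈ Q, ∀ c ∈ Q, ∀ d ∈ Q, a ≠ b → c ≠ d → a + b = c + d →
      (a = c ∧ b = d) ∨ (a = d ∧ b = c)) :
    ((Q ×ˢ Q).filter (fun x => x.1 / h = x.2 / h)).card ≤ Q.card + 4 * h := by
  set P := (Q ×ˢ Q).filter (fun x => x.1 / h = x.2 / h) with hP
  set U := (Q ×ˢ Q).filter (fun x => x.1 < x.2 ∧ x.1 / h = x.2 / h) with hUdef
  have hU : ∀ x ∈ U, x.1 ∈ Q ∧ x.2 ∈ Q ∧ x.1 < x.2 := by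
    intro x hx
    simp only [hUdef, mem_filter, mem_product] at hx
    exact ⟨hx.1.1, hx.1.2, hx.2.1⟩
  -- `P ⊆ diagonal ∪ U ∪ swap U`
  have hcover : P ⊆ Q.image (fun a => (a, a)) ∪ U ∪ U.image Prod.swap := by
    intro x hx
    simp only [hP, mem_filter, mem_product] at hx
    obtain ⟨⟨hx1, hx2⟩, hblk⟩ := hx
    rcases lt_trichotomy x.1 x.2 with hlt | heq | hgt
    · apply mem_union_left; apply mem_union_right
      simp only [hUdef, mem_filter, mem_product]
      exact ⟨⟨hx1, hx2⟩, hlt, hblk⟩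
    · apply mem_union_left; apply mem_union_left
      exact mem_image.2 ⟨x.1, hx1, Prod.ext rfl heq⟩
    · apply mem_union_right
      refine mem_image.2 ⟨x.swap, ?_, Prod.swap_swap x⟩
      simp only [hUdef, mem_filter, mem_product, Prod.fst_swap, Prod.snd_swap]
      exact ⟨⟨hx2, hx1⟩, hgt, hblk.symm⟩
  -- `|U| ≤ 2 (h - 1)`: differences lie in `[1, h)` and each is attained at most twice
  have hUcard : U.card ≤ 2 * (h - 1) := by
    have hmaps : ∀ x ∈ U, x.2 - x.1 ∈ Finset.Ico 1 h := by
      intro x hx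
      simp only [hUdef, mem_filter, mem_product] at hx
      obtain ⟨-, hlt, hblk⟩ := hx
      rw [mem_Ico]
      refine ⟨by omega, ?_⟩
      -- same block ⇒ `x.2 < x.1 + h`
      have h1 : h * (x.2 / h) ≤ x.1 := hblk ▸ Nat.mul_div_le x.1 h
      have h2 : x.2 < h * (x.2 / h) + h := by
        have := Nat.lt_mul_div_succ x.2 (show 0 < h by omega)
        rw [Nat.mul_succ] at this
        exact this
      omega
    have := Finset.card_le_mul_card_image_of_maps_to hmaps 2
      (fun d _ => shm_card_pairs_with_diff_le_two Q hws U hU d)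
    simpa using this
  calc P.card ≤ (Q.image (fun a => (a, a)) ∪ U ∪ U.image Prod.swap).card := card_le_card hcover
    _ ≤ (Q.image (fun a => (a, a)) ∪ U).card + (U.image Prod.swap).card := card_union_le _ _
    _ ≤ (Q.image (fun a => (a, a))).card + U.card + (U.image Prod.swap).card := by
        gcongr; exact card_union_le _ _
    _ ≤ Q.card + U.card + U.card := by
        have h1 : (Q.image (fun a => (a, a))).card ≤ Q.card := card_image_le
        have h2 : (U.image Prod.swap).card ≤ U.card := card_image_le
        omega
    _ ≤ Q.card + 4 * h := by omega

/-- The block-count function `x_j = #{a ∈ Q : a / h = j}` has `Σ_j x_j² = #{(a,b) ∈ Q² : a/h = b/h}`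
(fibrewise count). [folklore] -/
theorem shm_sum_sq_blockCount_eq (Q : Finset ℕ) (h N : ℕ) (hN : ∀ a ∈ Q, a / h < N) :
    ∑ j ∈ range N, (((Q.filter (fun a => a / h = j)).card : ℝ)) ^ 2 =
      (((Q ×ˢ Q).filter (fun x => x.1 / h = x.2 / h)).card : ℝ) := by
  set P := (Q ×ˢ Q).filter (fun x => x.1 / h = x.2 / h) with hP
  have hmaps : ∀ x ∈ P, x.1 / h ∈ range N := by
    intro x hx
    simp only [hP, mem_filter, mem_product] at hx
    exact mem_range.2 (hN x.1 hx.1.1)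
  rw [card_eq_sum_card_fiberwise hmaps]
  push_cast
  refine sum_congr rfl fun j _ => ?_
  have hfib : P.filter (fun x => x.1 / h = j) =
      (Q.filter (fun a => a / h = j)) ×ˢ (Q.filter (fun a => a / h = j)) := by
    ext x
    simp only [hP, mem_filter, mem_product]
    constructor
    · rintro ⟨⟨⟨h1, h2⟩, hblk⟩, hj⟩
      exact ⟨⟨h1, hj⟩, h2, by rw [← hblk, hj]⟩
    · rintro ⟨⟨h1, hj1⟩, h2, hj2⟩
      exact ⟨⟨⟨h1, h2⟩, by rw [hj1, hj2]⟩, hj1⟩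
  rw [hfib, card_product]
  push_cast
  ring

/-- **Sidon harmonic mass** (strategist signature `Strategist.SidonHarmonicMass`, census §Transfer T1,
`Cruxes/CharPSparseSOS/Strategist_Sketch.lean`, verbatim): for a weak-Sidon set `Q ⊆ ℕ`, `1 ≤ h` and
`4h ≤ L`, the pairs `a < b` of `Q` with `a + b ≥ L` have harmonic mass
`Σ 1/(a + b) ≤ (π/(2h))·(4h + |Q|)·(1 + 4h/L)`.  Proof: with `j = a/h`, `k = b/h` one has
`1/(a+b) ≤ (1 + 4h/L)/(h·((j+1)+(k+1)))` (since `h(j+k) ≤ a+b` and `2h ≤ 4h(a+b)/L`); symmetrising, the sum is at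
most `((1+4h/L)/(2h))·Σ_{j,k} x_j x_k/((j+1)+(k+1))` with the block counts `x_j`, and Hilbert's inequality
with `Σ_j x_j² ≤ |Q| + 4h` (`shm_card_sameBlock_le`) finishes.  (Erdős's argument for `|Sidon ∩ [1,N]| ≤ √N + O(N^{1/4})`
uses the same block count.) -/
theorem sidonHarmonicMass : ∀ (Q : Finset ℕ) (h L : ℕ), 1 ≤ h → 4 * h ≤ L → (∀ a ∈ Q, ∀ b ∈ Q, ∀ c ∈ Q, ∀ d ∈ Q, a ≠ b → c ≠ d → a + b = c + d → (a = c ∧ b = d) ∨ (a = d ∧ b = c)) → (∑ x ∈ (Q ×ˢ Q).filter (fun x => x.1 < x.2 ∧ L ≤ x.1 + x.2), (1 : ℝ) / ((x.1 : ℝ) + x.2)) ≤ Real.pi / (2 * h) * (4 * h + Q.card) * (1 + 4 * (h : ℝ) / L) := by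
  intro Q h L hh hL hws
  -- notation
  have hh0 : (0 : ℝ) < h := by exact_mod_cast (show 0 < h by omega)
  have hL0 : (0 : ℝ) < L := by exact_mod_cast (show 0 < L by omega)
  set κ : ℝ := (1 + 4 * (h : ℝ) / L) / h with hκ
  have hκ0 : 0 ≤ κ := by positivity
  set g : ℕ × ℕ → ℝ := fun x => 1 / ((((x.1 / h : ℕ) : ℝ) + 1) + (((x.2 / h : ℕ) : ℝ) + 1)) with hg
  have hg0 : ∀ x, 0 ≤ g x := fun x => by positivity
  have hgsymm : ∀ x : ℕ × ℕ, g x.swap = g x := by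
    intro x; simp only [hg, Prod.fst_swap, Prod.snd_swap]; rw [add_comm]
  set T := (Q ×ˢ Q).filter (fun x => x.1 < x.2 ∧ L ≤ x.1 + x.2) with hT
  -- Step 1: termwise comparison with the block kernel
  have hterm : ∀ x ∈ T, (1 : ℝ) / ((x.1 : ℝ) + x.2) ≤ κ * g x := by
    intro x hx
    simp only [hT, mem_filter, mem_product] at hx
    obtain ⟨-, -, hLx⟩ := hx
    have hj : ((x.1 / h : ℕ) : ℝ) * h ≤ x.1 := by exact_mod_cast Nat.div_mul_le_self x.1 h
    have hk : ((x.2 / h : ℕ) : ℝ) * h ≤ x.2 := by exact_mod_cast Nat.div_mul_le_self x.2 h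
    have hab : (L : ℝ) ≤ (x.1 : ℝ) + x.2 := by exact_mod_cast hLx
    have hab0 : (0 : ℝ) < (x.1 : ℝ) + x.2 := lt_of_lt_of_le hL0 hab
    have hden : (0 : ℝ) < (((x.1 / h : ℕ) : ℝ) + 1) + (((x.2 / h : ℕ) : ℝ) + 1) := by positivity
    simp only [hg, hκ]
    rw [mul_one_div, div_div, div_le_div_iff₀ hab0 (by positivity), one_mul]
    -- goal: h * ((j+1)+(k+1)) ≤ (1 + 4h/L) * (a+b)
    have h4 : 4 * (h : ℝ) ≤ 4 * (h : ℝ) / L * ((x.1 : ℝ) + x.2) := by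
      rw [div_mul_eq_mul_div, le_div_iff₀ hL0]
      nlinarith
    nlinarith [hj, hk, h4]
  -- Step 2: sum over T ≤ κ/2 · sum over Q × Q
  have hstep2 : ∑ x ∈ T, (1 : ℝ) / ((x.1 : ℝ) + x.2) ≤ κ * ((∑ x ∈ Q ×ˢ Q, g x) / 2) := by
    have h1 : ∑ x ∈ T, (1 : ℝ) / ((x.1 : ℝ) + x.2) ≤ ∑ x ∈ T, κ * g x := sum_le_sum hterm
    have h2 : ∑ x ∈ T, κ * g x ≤ ∑ x ∈ (Q ×ˢ Q).filter (fun x : ℕ × ℕ => x.1 < x.2), κ * g x := by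
      apply sum_le_sum_of_subset_of_nonneg
      · intro x hx
        simp only [hT, mem_filter] at hx ⊢
        exact ⟨hx.1, hx.2.1⟩
      · intro x _ _; exact mul_nonneg hκ0 (hg0 x)
    have h3 : 2 * ∑ x ∈ (Q ×ˢ Q).filter (fun x : ℕ × ℕ => x.1 < x.2), g x ≤ ∑ x ∈ Q ×ˢ Q, g x := by
      rw [qrp_sum_product_split Q g]
      have hsw : ∑ x ∈ (Q ×ˢ Q).filter (fun x : ℕ × ℕ => x.1 < x.2), g x.swap =
          ∑ x ∈ (Q ×ˢ Q).filter (fun x : ℕ × ℕ => x.1 < x.2), g x := sum_congr rfl fun x _ => hgsymm x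
      rw [hsw]
      have hdiag : 0 ≤ ∑ a ∈ Q, g (a, a) := sum_nonneg fun a _ => hg0 _
      linarith
    rw [← mul_sum, ← mul_sum] at h2
    rw [← mul_sum] at h1
    have h4 : κ * ∑ x ∈ (Q ×ˢ Q).filter (fun x : ℕ × ℕ => x.1 < x.2), g x ≤ κ * ((∑ x ∈ Q ×ˢ Q, g x) / 2) :=
      mul_le_mul_of_nonneg_left (by linarith) hκ0
    exact h1.trans (h2.trans h4)
  -- Step 3: the sum over Q × Q is the Hilbert bilinear form of the block counts
  obtain ⟨N, hN⟩ : ∃ N : ℕ, ∀ a ∈ Q, a / h < N :=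
    ⟨Q.sup id / h + 1, fun a ha => Nat.lt_succ_of_le (Nat.div_le_div_right (Finset.le_sup (f := id) ha))⟩
  set xc : ℕ → ℝ := fun j => ((Q.filter (fun a => a / h = j)).card : ℝ) with hxc
  have hstep3 : ∑ x ∈ Q ×ˢ Q, g x =
      ∑ i ∈ range N, ∑ j ∈ range N, xc i * xc j / (((i : ℝ) + 1) + ((j : ℝ) + 1)) := by
    rw [sum_product]
    have hmapsQ : ∀ a ∈ Q, a / h ∈ range N := fun a ha => mem_range.2 (hN a ha)
    rw [← sum_fiberwise_of_maps_to hmapsQ]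
    refine sum_congr rfl fun i _ => ?_
    -- inner: for `a` in the fibre over `i`
    have inner : ∀ a ∈ Q.filter (fun a => a / h = i), ∑ b ∈ Q, g (a, b) =
        ∑ j ∈ range N, xc j / (((i : ℝ) + 1) + ((j : ℝ) + 1)) := by
      intro a ha
      rw [mem_filter] at ha
      rw [← sum_fiberwise_of_maps_to hmapsQ]
      refine sum_congr rfl fun j _ => ?_
      have hconst : ∀ b ∈ Q.filter (fun b => b / h = j), g (a, b) = 1 / (((i : ℝ) + 1) + ((j : ℝ) + 1)) := by
        intro b hb
        rw [mem_filter] at hb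
        simp only [hg, ha.2, hb.2]
      rw [sum_congr rfl hconst, sum_const, nsmul_eq_mul, hxc]
      ring
    rw [sum_congr rfl inner, sum_const, nsmul_eq_mul, hxc, mul_sum]
    refine sum_congr rfl fun j _ => ?_
    ring
  -- Step 4: Hilbert's inequality and the block count
  have hstep4 : ∑ x ∈ Q ×ˢ Q, g x ≤ Real.pi * ((Q.card : ℝ) + 4 * h) := by
    rw [hstep3]
    refine (hilbert_inequality N xc).trans ?_
    refine mul_le_mul_of_nonneg_left ?_ Real.pi_pos.le
    rw [hxc, shm_sum_sq_blockCount_eq Q h N hN]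
    exact_mod_cast shm_card_sameBlock_le Q h hh hws
  -- Step 5: assemble
  calc ∑ x ∈ T, (1 : ℝ) / ((x.1 : ℝ) + x.2) ≤ κ * ((∑ x ∈ Q ×ˢ Q, g x) / 2) := hstep2
    _ ≤ κ * (Real.pi * ((Q.card : ℝ) + 4 * h) / 2) := by
        refine mul_le_mul_of_nonneg_left ?_ hκ0
        linarith
    _ = Real.pi / (2 * h) * (4 * h + Q.card) * (1 + 4 * (h : ℝ) / L) := by
        rw [hκ]
        field_simp
        ring


/-- The harmonic sum over `[L, N)` dominates `log (N / L)` for `1 ≤ L ≤ N` (integral test for `1/x`). [folklore] -/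
theorem shm_log_div_le_sum_inv (L N : ℕ) (hL : 1 ≤ L) (hLN : L ≤ N) :
    Real.log ((N : ℝ) / L) ≤ ∑ n ∈ Ico L N, (1 : ℝ) / n := by
  have hL0 : (0 : ℝ) < L := by exact_mod_cast hL
  have hanti : AntitoneOn (fun x : ℝ => 1 / x) (Set.Icc (L : ℝ) ((L : ℝ) + ((N - L : ℕ) : ℝ))) := by
    intro x hx y hy hxy
    have hx0 : 0 < x := lt_of_lt_of_le hL0 hx.1
    exact one_div_le_one_div_of_le hx0 hxy
  have hint := hanti.integral_le_sum
  have hNL : (L : ℝ) + ((N - L : ℕ) : ℝ) = N := by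
    rw [Nat.cast_sub hLN]; ring
  rw [hNL] at hint
  have hval : ∫ x in (L : ℝ)..N, (1 : ℝ) / x = Real.log ((N : ℝ) / L) :=
    integral_one_div_of_pos hL0 (by exact_mod_cast (show 0 < N by omega))
  rw [hval] at hint
  refine hint.trans (le_of_eq ?_)
  rw [Finset.sum_Ico_eq_sum_range]
  refine sum_congr rfl fun i _ => ?_
  push_cast; ring

/-- **Ordered bounded-fan-in obstruction** (strategist signature `Strategist.OrderedBoundedFaninObstruction`,
census §Transfer T1, verbatim): if every `n ∈ [L, N)` is a restricted sum `a + b` (`a < b`) from one of `s'`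
weak-Sidon sets `Q_i ⊆ ℕ` of size `≤ h`, where `1 ≤ h`, `4h ≤ L < N`, then
`log(N/L) − 1 ≤ s'·((π/(2h))·(5h)·2)`.  Proof: `log(N/L) ≤ Σ_{L ≤ n < N} 1/n` (`shm_log_div_le_sum_inv`); each
`n` is `a + b` for a pair of some piece, and distinct `n` use distinct pairs, so the harmonic sum is at most the
total harmonic mass of the pieces' pairs with `a + b ≥ L`, which `sidonHarmonicMass` bounds by
`(π/(2h))·(4h + h)·(1 + 4h/L) ≤ (π/(2h))·(5h)·2` per piece. -/
theorem orderedBoundedFaninObstruction : ∀ (s' : ℕ) (Qs : Fin s' → Finset ℕ) (L N h : ℕ), 1 ≤ h → 4 * h ≤ L → L < N → (∀ i, ∀ a ∈ Qs i, ∀ b ∈ Qs i, ∀ c ∈ Qs i, ∀ d ∈ Qs i, a ≠ b → c ≠ d → a + b = c + d → (a = c ∧ b = d) ∨ (a = d ∧ b = c)) → (∀ i, (Qs i).card ≤ h) → (∀ n, L ≤ n → n < N → ∃ i, ∃ a ∈ Qs i, ∃ b ∈ Qs i, a < b ∧ a + b = n) → Real.log ((N : ℝ) / L) - 1 ≤ (s'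 : ℝ) * (Real.pi / (2 * h) * (5 * h) * 2) := by
  intro s' Qs L N h hh hL hLN hws hcard hcov
  have hh0 : (0 : ℝ) < h := by exact_mod_cast (show 0 < h by omega)
  have hL0 : (0 : ℝ) < L := by exact_mod_cast (show 0 < L by omega)
  set T : Fin s' → Finset (ℕ × ℕ) := fun i => ((Qs i) ×ˢ (Qs i)).filter (fun x => x.1 < x.2 ∧ L ≤ x.1 + x.2)
    with hT
  set w : ℕ × ℕ → ℝ := fun x => (1 : ℝ) / ((x.1 : ℝ) + x.2) with hw
  have hw0 : ∀ x, 0 ≤ w x := fun x => by positivity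
  -- (1) the harmonic sum over `[L, N)` is dominated by the total harmonic mass of the pieces
  have hcover : ∑ n ∈ Ico L N, (1 : ℝ) / n ≤ ∑ i, ∑ x ∈ T i, w x := by
    -- pointwise: `1/n ≤ Σ_i Σ_{x ∈ T_i, x.1 + x.2 = n} w x`
    have hpt : ∀ n ∈ Ico L N, (1 : ℝ) / n ≤ ∑ i, ∑ x ∈ (T i).filter (fun x => x.1 + x.2 = n), w x := by
      intro n hn
      rw [mem_Ico] at hn
      obtain ⟨i, a, ha, b, hb, hab, habn⟩ := hcov n hn.1 hn.2
      have hmem : (a, b) ∈ (T i).filter (fun x => x.1 + x.2 = n) := by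
        simp only [hT, mem_filter, mem_product]
        exact ⟨⟨⟨ha, hb⟩, hab, habn ▸ hn.1⟩, habn⟩
      have h1 : w (a, b) ≤ ∑ x ∈ (T i).filter (fun x => x.1 + x.2 = n), w x :=
        single_le_sum (fun x _ => hw0 x) hmem
      have h2 : ∑ x ∈ (T i).filter (fun x => x.1 + x.2 = n), w x ≤
          ∑ i, ∑ x ∈ (T i).filter (fun x => x.1 + x.2 = n), w x :=
        single_le_sum (f := fun i => ∑ x ∈ (T i).filter (fun x => x.1 + x.2 = n), w x)
          (fun i _ => sum_nonneg fun x _ => hw0 x) (mem_univ i)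
      have h0 : w (a, b) = 1 / (n : ℝ) := by
        simp only [hw]; rw [← habn]; push_cast; ring
      linarith
    refine (sum_le_sum hpt).trans ?_
    rw [sum_comm]
    refine sum_le_sum fun i _ => ?_
    -- `Σ_n Σ_{fibre} = Σ over the pairs with sum in [L, N)` ≤ `Σ over T i`
    have hmaps : ∀ x ∈ (T i).filter (fun x => x.1 + x.2 < N), x.1 + x.2 ∈ Ico L N := by
      intro x hx
      simp only [hT, mem_filter, mem_product] at hx
      exact mem_Ico.2 ⟨hx.1.2.2, hx.2⟩
    have hfib := sum_fiberwise_of_maps_to hmaps (f := w)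
    have hrw : ∀ n ∈ Ico L N, ∑ x ∈ ((T i).filter (fun x => x.1 + x.2 < N)).filter (fun x => x.1 + x.2 = n), w x =
        ∑ x ∈ (T i).filter (fun x => x.1 + x.2 = n), w x := by
      intro n hn
      rw [mem_Ico] at hn
      refine sum_congr ?_ fun _ _ => rfl
      ext x
      simp only [mem_filter]
      constructor
      · rintro ⟨⟨h1, -⟩, h2⟩; exact ⟨h1, h2⟩
      · rintro ⟨h1, h2⟩; exact ⟨⟨h1, by omega⟩, h2⟩
    rw [sum_congr rfl hrw] at hfib
    rw [hfib]
    exact sum_le_sum_of_subset_of_nonneg (filter_subset _ _) fun x _ _ => hw0 x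
  -- (2) each piece has harmonic mass ≤ (π/(2h))·(5h)·2
  have hpiece : ∀ i, ∑ x ∈ T i, w x ≤ Real.pi / (2 * h) * (5 * h) * 2 := by
    intro i
    have hm := sidonHarmonicMass (Qs i) h L hh hL (hws i)
    refine hm.trans ?_
    have hc : ((Qs i).card : ℝ) ≤ h := by exact_mod_cast hcard i
    have hfac : 1 + 4 * (h : ℝ) / L ≤ 2 := by
      have h4 : 4 * (h : ℝ) / L ≤ 1 := (div_le_one hL0).2 (by exact_mod_cast hL)
      linarith
    have hpos : 0 ≤ Real.pi / (2 * h) := by positivity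
    have h5 : Real.pi / (2 * h) * (4 * h + ((Qs i).card : ℝ)) ≤ Real.pi / (2 * h) * (5 * h) :=
      mul_le_mul_of_nonneg_left (by linarith) hpos
    exact mul_le_mul h5 hfac (by positivity) (by positivity)
  -- (3) assemble
  have hlog := shm_log_div_le_sum_inv L N (by omega) hLN.le
  have htot : ∑ i, ∑ x ∈ T i, w x ≤ (s' : ℝ) * (Real.pi / (2 * h) * (5 * h) * 2) := by
    refine (sum_le_sum fun i _ => hpiece i).trans (le_of_eq ?_)
    rw [sum_const, card_univ, Fintype.card_fin, nsmul_eq_mul]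
  linarith [hlog, hcover, htot]

end Summit.ValiantsHypothesis.ValiantsHypothesis.Theorems.CharPSparseSOSTwoCusp
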